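import Literature.NumberTheory.Automorphic.SiegelTranslateCover
import Literature.NumberTheory.Automorphic.SiegelReducedFamilies
import Literature.NumberTheory.Automorphic.CompletedCohomologyHeckeAlgebraGLn
import Literature.Algebra.Homology.GroupCohomologyEquivariantGoodCover
import Literature.Algebra.Homology.GroupCohomologyFiniteIndexModuleFinite
import Literature.NumberTheory.Automorphic.SiegelReducedFamiliesHull
import Literature.NumberTheory.Automorphic.CongruenceSubgroupCohomologyFiniteDimensional
import Literature.NumberTheory.Automorphic.ArithmeticGroupCohomologyFiniteness
import Literature.NumberTheory.Automorphic.AdelicStabilizerArithmetic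
import Literature.NumberTheory.Automorphic.ArithmeticQuotientCohomologyFiniteProofs
import Literature.NumberTheory.Automorphic.GLnAdelicStructureProofs
import Literature.NumberTheory.Automorphic.ArithmeticQuotientCohomologyFinite
import Literature.NumberTheory.Automorphic.BorelSerreSiegelReducedFamilies
import HarnessLib

/-!
# Borel–Serre finiteness of `H^q(Γ, A)` for congruence subgroups of `GL_n` over number fields (finite and field coefficients) and for subgroups of finite index of `GL_n(ℤ)` — the three `BorelSerre1973_…` named facts HOLD (re-homed proofs)

**Borel–Serre finiteness for arithmetic subgroups of `GL_n`: (i) for a number field `K`, a compact open `U ≤ GL_n(𝔸_K^∞)`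
and `Γ_U = GL_n(K) ∩ U`, `H^q(Γ_U, A)` is FINITE for every `ℤ[Γ_U]`-module `A` with finitely many elements and FINITE-DIMENSIONAL
for every finite-dimensional representation `A` over a field `k`; (ii) for every subgroup `Γ` of finite index in `GL_n(ℤ)`
(Mathlib's `Matrix.GeneralLinearGroup (Fin n) ℤ`) and every finite-dimensional `k`-linear `A`, `H^q(Γ, A)` is finite-dimensional**
— A. Borel, J.-P. Serre, *Corners and arithmetic groups*, Comment. Math. Helv. 48 (1973) §11.1 (arithmetic groups are of type
(WFL)), Thm. 11.4.4 [BorelSerre1973]; K. S. Brown, *Cohomology of Groups* (1982) VII (7.10), VIII §2, VIII (5.1), III (6.2)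
[Brown1982CohomologyGroups]; J.-P. Serre, *Cohomologie des groupes discrets* (1971) §2.4 Th. 4 [Serre1971CohomologieGroupesDiscrets]
— the EXACT discharges `BorelSerre1973_finite_groupCohomology_congruenceSubgroup_holds` (`ArithmeticQuotientCohomologyFinite.lean`),
`BorelSerre1973_finiteDimensional_groupCohomology_congruenceSubgroup_holds` (`CongruenceSubgroupCohomologyFiniteDimensional.lean`) and
`BorelSerre1973_finiteDimensional_groupCohomology_holds` (`ArithmeticGroupCohomologyFiniteness.lean`) of the three Literature named
facts, all in `Literature.NumberTheory.Automorphic`.  RE-HOMED into `Literature/` by the Hodge foundations lane (`lit-hodgefound`,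
seat p20, generation 37): verbatim DECLARATION-LEVEL ports, in dependency order and each with its original module docstring, of the
theorem-only modules `Summits/Langlands/Langlands/Theorems/IrreducibilityBySelfDualityHeckeEigenvalueField{StubAssemblyFinite,
StubModuleFiniteGoodCover, StubAssembly, BorelSerre}.lean`, namespace `Summit.Langlands.Langlands.Theorems.HeckeEigenvalueField.Res`
re-rooted as `Literature.NumberTheory.Automorphic.BorelSerre1973`; the reduction-theoretic inputs are the sibling file
`BorelSerreSiegelReducedFamilies.lean`, the Hull Lemma is `SiegelReducedFamiliesHull.lean`, Brown's criterion for finite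
coefficients and the equivariant good covers are `Literature/Algebra/Homology/GroupCohomologyEquivariantGoodCover.lean`,
`GroupCohomologyFiniteIndexModuleFinite.lean`, the Siegel translate cover is `SiegelTranslateCover.lean`.

PROOF AS FORMALISED (the Čech-nerve route, NOT the Borel–Serre bordification of the printed source — a deviation of method, not of
statement): `Γ_U` acts on the cone model `X` of positive definite Hermitian forms over `K ⊗ ℝ` (contractible, proper action with
finite stabilisers); the translates of the convex hull of a reduced family by `Γ_U` form an invariant good cover with finitely many
orbits of simplices (reduction theory: fundamental set, Siegel property, sandwich, Hull Lemma); Brown's criterion VII (7.10) in Čech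
form gives finiteness / finite generation of `H^q(Γ_U, A)`; the `GL_n(ℤ)` case is `K = ℚ`, `U = GL_n(𝒪̂)` transported along
`GL_n(𝓞_ℚ) ≃* GL_n(ℤ)`, with Shapiro descent to finite index.  Theorem-only file: no definition, no new named fact (D-0026); imports
Mathlib/Literature only.  The only previous proofs were the Summits-side twins, which `Literature/` cannot import; the Summits
originals stay in place (transitional duplication).  Nothing here bears on any summit statement.
-/

noncomputable section

/-!
## Part 1 — port of `Summits/Langlands/Langlands/Theorems/IrreducibilityBySelfDualityHeckeEigenvalueFieldStubAssemblyFinite.lean`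

# Borel–Serre finiteness for congruence subgroups of `GL_n` with finite coefficients — the
# assembly

This file is the FINITE-COEFFICIENT TWIN of
the `borelSerre_assembly`
(`Summits/Langlands/Langlands/Theorems/IrreducibilityBySelfDualityHeckeEigenvalueFieldStubAssembly`).
For a number field `K`, a compact open `U ≤ GL_n(𝔸_K^∞)`, the congruence subgroup
`Γ_U = GL_n(K) ∩ U` and a representation `A` of `Γ_U` over `ℤ` with finitely many elements, every
`H^q(Γ_U, A)` is finite ([BorelSerre1973, §11.1, Thm. 11.4.4]; [Brown1982CohomologyGroups,
VIII §2]).  Its conclusion is VERBATIM the text of the named fact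
`Literature.NumberTheory.Automorphic.BorelSerre1973_finite_groupCohomology_congruenceSubgroup`
(`Literature/NumberTheory/Automorphic/ArithmeticQuotientCohomologyFinite`, consumed by
`BigHeckeGLn.TameLevel.hidaCohomology_finite_of_borelSerre`), so that — once fed with the theorems `hull_convex`, `hull_relOpen`, `hull_posDef`, `sandwich_in`,
`sandwich_out` for its five hypotheses — it discharges that named fact.  The hypotheses are
those of `borelSerre_assembly`, character for character: the Hull Lemma (`hHull`), the relative
openness (`hOpen`) and positivity (`hPos`) of Siegel-reduced families, and the two halves of the
sandwich of the archimedean Siegel domain between reduced families (`hIn`, `hOut`).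

Proof.  The PROOF BODY DUPLICATES that of the `borelSerre_assembly` (the tree file is
append-only and its cover is built inside one `theorem`, so it cannot be shared by name); only the
last step differs.  `Γ_U` acts through `θ = GL_n(mixedEmbedding K)` on the contractible cone
`X ⊆ M_n(K ⊗ ℝ)` of matrices positive definite at every place, by `g • H = g H gᴴ`
(`coneModel`: transitive, stabiliser of `1` equal to `K_∞`, convex).  The prototype open set is
the CONVEX HULL `V = conv R₀` of the set `R₀` of matrices with `(c, C, τ)`-reduced family of places,
the constants being those of sandwich-in for Borel's fundamental set (`archFundamentalSet`):
`V` lies in the cone (`hPos`), in the `(c', C', τ')`-reduced matrices (`hHull`), hence in the image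
`𝔖' • 1` of a second archimedean Siegel set (`hOut`), and it is relatively open in the self-adjoint
matrices (`hOpen` and `assembly_convexHull_inter_relOpen`), so that its trace on the cone is open.
With the Siegel set `𝔖♯ = {h : h hᴴ ∈ V}` the fundamental-set property holds by sandwich-in and
the Siegel property by `archSiegelProperty` for `𝔖'`; hence
(`SiegelCover.exists_cover_data_of_fundamentalSet_of_siegelProperty`) the translates `θ(γ) • V`,
`γ_f ∈ U Q`, form a `Γ_U`-equivariant open cover of `X` indexed by a free `Γ_U`-set with finitely
many orbits of nerve simplices, whose non-empty finite intersections are convex, hence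
contractible.  None of this depends on the coefficients; the tree's ORIGINAL criterion for finite
coefficients, `Literature.Algebra.Homology.finite_groupCohomology_int_of_free_equivariantGoodCover`
(Brown's criterion in Čech form, [Brown1982CohomologyGroups, VII (7.10), VIII §2]), concludes.

## References

* A. Borel, J.-P. Serre, *Corners and arithmetic groups*, Comment. Math. Helv. 48 (1973), §11.1,
  Thm. 11.4.4 [BorelSerre1973].
* K. S. Brown, *Cohomology of Groups*, GTM 87 (1982), VII (7.10), VIII §2
  [Brown1982CohomologyGroups].
* A. Borel, *Introduction aux groupes arithmétiques*, Hermann (1969), §13, §15 [Borel1969].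
-/

section Part1

open scoped _root_.Classical _root_.Pointwise ComplexOrder _root_.Matrix
open _root_.Filter _root_.NumberField NumberField.mixedEmbedding _root_.IsDedekindDomain _root_.CategoryTheory
open Literature.NumberTheory.Automorphic Literature.Algebra.Homology
open Literature.AlgebraicTopology.SingularHomology

namespace Literature.NumberTheory.Automorphic.BorelSerre1973

open BigHeckeGLn

/-- **ASSEMBLY, finite coefficients — Borel–Serre finiteness of `H^q(Γ_U, A)` for
congruence subgroups of `GL_n` over a number field and `A` a `ℤ[Γ_U]`-module with finitely many
elements, from the Hull Lemma, the relative openness and positivity of reduced families, the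
sandwich of the archimedean Siegel domain, and the inputs above** (the tree's criterion
`finite_groupCohomology_int_of_free_equivariantGoodCover` — Brown's criterion in Čech form for
finite coefficients — applied to the cover of the cone of positive forms over `K ⊗ ℝ` by the
`Γ_U`-translates of the convex hull of the reduced matrices: free index set `{γ : γ_f ∈ U Q}`,
finitely many orbits of nerve simplices by the fundamental set and the Siegel property, contractible
intersections by convexity).  The conclusion is the text of the named fact
`BorelSerre1973_finite_groupCohomology_congruenceSubgroup`.
[cite: BorelSerre1973, §11.1, Thm. 11.4.4] [cite: Brown1982CohomologyGroups, VII (7.10); VIII §2]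
[cite: Borel1969, §13 and §15] -/
theorem borelSerre_assembly_finite
    (hHull : ∀ (ι : Type) (m : ℕ) (c C τ : ℝ), ∃ c' C' τ' : ℝ,
      convexHull ℝ {H : ι → Matrix (Fin m) (Fin m) ℂ | SiegelFamily.IsReduced c C τ m H} ⊆
        {H | SiegelFamily.IsReduced c' C' τ' m H})
    (hOpen : ∀ (ι : Type) [Finite ι] (m : ℕ) (c C τ : ℝ), ∃ O : Set (ι → Matrix (Fin m) (Fin m) ℂ),
      IsOpen O ∧ {H | SiegelFamily.IsReduced c C τ m H} = {H | ∀ w, (H w).IsHermitian} ∩ O)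
    (hPos : (∀ (ι : Type) (m : ℕ) (c C τ : ℝ) (H : ι → Matrix (Fin m) (Fin m) ℂ),
        SiegelFamily.IsReduced c C τ m H → ∀ w, (H w).PosDef) ∧
      (∀ (n : ℕ) (K : Type) [Field K] [NumberField K] (c C τ : ℝ)
        (H : Matrix (Fin n) (Fin n) (mixedSpace K)),
        SiegelFamily.IsReduced c C τ n (SiegelFamily.placeFamily K H) →
          (∀ w, (H.map (mixedSpaceEvalReal K w)).PosDef) ∧
            ∀ w, (H.map (mixedSpaceEvalComplex K w)).PosDef))
    (hIn : ∀ (n : ℕ) (K : Type) [Field K] [NumberField K]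
      (Ω : Set (GL (Fin n) (AdeleRing (𝓞 K) K))),
      Ω ⊆ (standardParabolicGL (AdeleRing (𝓞 K) K) (id : Fin n → Fin n) :
        Set (GL (Fin n) (AdeleRing (𝓞 K) K))) →
      Ω ⊆ Set.range (GLn.ofInfinite n K) → IsCompact (closure Ω) → ∀ (t : ℝ), 0 < t →
      ∃ c C τ : ℝ, ∀ b ∈ GLn.toMixed n K ''
          (((posRealScalar n K).range : Set (GL (Fin n) (AdeleRing (𝓞 K) K))) * Ω * siegelCone n K t),
        SiegelFamily.IsReduced c C τ n (SiegelFamily.placeFamily K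
          ((b : Matrix (Fin n) (Fin n) (mixedSpace K)) * (b : Matrix (Fin n) (Fin n) (mixedSpace K))ᴴ)))
    (hOut : ∀ (n : ℕ) (K : Type) [Field K] [NumberField K] (c C τ : ℝ),
      ∃ (Ω : Set (GL (Fin n) (AdeleRing (𝓞 K) K))) (t : ℝ), 0 < t ∧
        Ω ⊆ (standardParabolicGL (AdeleRing (𝓞 K) K) (id : Fin n → Fin n) :
          Set (GL (Fin n) (AdeleRing (𝓞 K) K))) ∧
        Ω ⊆ Set.range (GLn.ofInfinite n K) ∧ IsCompact (closure Ω) ∧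
        ∀ H : Matrix (Fin n) (Fin n) (mixedSpace K),
          SiegelFamily.IsReduced c C τ n (SiegelFamily.placeFamily K H) →
            ∃ b ∈ GLn.toMixed n K ''
                (((posRealScalar n K).range : Set (GL (Fin n) (AdeleRing (𝓞 K) K))) * Ω *
                  siegelCone n K t),
              (b : Matrix (Fin n) (Fin n) (mixedSpace K)) *
                (b : Matrix (Fin n) (Fin n) (mixedSpace K))ᴴ = H) :
    ∀ (n : ℕ) (K : Type) [Field K] [NumberField K] (U : Subgroup (FiniteAdelicGL n K)),
      IsOpen (U : Set (FiniteAdelicGL n K)) → IsCompact (U : Set (FiniteAdelicGL n K)) →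
      ∀ (A : Rep ℤ (U.comap (globalEmbedding n K))), Finite A →
        ∀ q : ℕ, Finite (groupCohomology A q) := by
  intro n K _ _ U hUo hUc A hA q
  classical
  -- (0) the cone model: `E = M_n(K ⊗ ℝ)`, the cone `C₀`, the action `g • H = g H gᴴ`, `x₀ = 1`
  obtain ⟨htrans, hstab, hinv, hconv⟩ := coneModel n K
  set C₀ : Set (Matrix (Fin n) (Fin n) (mixedSpace K)) :=
    {H | (∀ w, (H.map (mixedSpaceEvalReal K w)).PosDef) ∧
      ∀ w, (H.map (mixedSpaceEvalComplex K w)).PosDef} with hC₀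
  letI instGL : MulAction (GL (Fin n) (mixedSpace K)) ↥C₀ :=
    { smul := fun g x => ⟨(g : Matrix (Fin n) (Fin n) (mixedSpace K)) * x *
          (g : Matrix (Fin n) (Fin n) (mixedSpace K))ᴴ, hinv g x.1 x.2.1 x.2.2⟩
      one_smul := fun x => Subtype.ext (by
        change ((1 : GL (Fin n) (mixedSpace K)) : Matrix (Fin n) (Fin n) (mixedSpace K)) * x *
          ((1 : GL (Fin n) (mixedSpace K)) : Matrix (Fin n) (Fin n) (mixedSpace K))ᴴ = x
        rw [Units.val_one, Matrix.conjTranspose_one, Matrix.one_mul, Matrix.mul_one])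
      mul_smul := fun g h x =>
        Subtype.ext (assembly_act_mul g h (x : Matrix (Fin n) (Fin n) (mixedSpace K))) }
  have hsmul_coe : ∀ (g : GL (Fin n) (mixedSpace K)) (x : ↥C₀),
      ((g • x : ↥C₀) : Matrix (Fin n) (Fin n) (mixedSpace K)) =
        (g : Matrix (Fin n) (Fin n) (mixedSpace K)) * x *
          (g : Matrix (Fin n) (Fin n) (mixedSpace K))ᴴ :=
    fun _ _ => rfl
  have hcont : ∀ g : GL (Fin n) (mixedSpace K), Continuous fun x : ↥C₀ => g • x := fun g =>
    ((assembly_continuous_act g).comp continuous_subtype_val).subtype_mk _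
  haveI : ContractibleSpace ↥C₀ := hconv.contractibleSpace ⟨1, assembly_one_mem_cone n K⟩
  set x₀ : ↥C₀ := ⟨1, assembly_one_mem_cone n K⟩ with hx₀
  set θ : GL (Fin n) K →* GL (Fin n) (mixedSpace K) :=
    Matrix.GeneralLinearGroup.map (mixedEmbedding K) with hθ
  have hf_apply : ∀ γ, globalEmbedding n K γ =
      Matrix.GeneralLinearGroup.map (algebraMap K (FiniteAdeleRing (𝓞 K) K)) γ := fun γ => rfl
  -- (1) the constants: fundamental set, sandwich-in, hull, sandwich-out
  obtain ⟨Ω, t, ht, hΩB, hΩinf, hΩc, Q₀, hQ₀, hcov₀⟩ := archFundamentalSet n K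
  obtain ⟨c, C, τ, hin⟩ := hIn n K Ω hΩB hΩinf hΩc t ht
  obtain ⟨c', C', τ', hhull⟩ := hHull (InfinitePlace K) n c C τ
  obtain ⟨Ω', t', ht', hΩ'B, hΩ'inf, hΩ'c, hout⟩ := hOut n K c' C' τ'
  -- (2) the prototype `V = conv R₀`
  set R₀ : Set (Matrix (Fin n) (Fin n) (mixedSpace K)) :=
    {H | SiegelFamily.IsReduced c C τ n (SiegelFamily.placeFamily K H)} with hR₀
  set V : Set (Matrix (Fin n) (Fin n) (mixedSpace K)) := convexHull ℝ R₀ with hV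
  -- (2a, b) `R₀ ⊆ C₀` (positivity of reduced families), `V ⊆ C₀` (convexity of the cone)
  have hR₀C₀ : R₀ ⊆ C₀ := fun H hH => hPos.2 n K c C τ H hH
  have hVC₀ : V ⊆ C₀ := convexHull_min hR₀C₀ hconv
  -- (2c) `V` lies in the `(c', C', τ')`-reduced matrices (the Hull Lemma)
  have hVR₁ : ∀ H ∈ V, SiegelFamily.IsReduced c' C' τ' n (SiegelFamily.placeFamily K H) := by
    intro H hH
    have h₁ : SiegelFamily.placeFamily K H ∈ SiegelFamily.placeFamilyₗ K n '' convexHull ℝ R₀ :=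
      ⟨H, hH, rfl⟩
    rw [LinearMap.image_convexHull] at h₁
    have h₂ : (SiegelFamily.placeFamilyₗ K n) '' R₀ ⊆
        {F | SiegelFamily.IsReduced c C τ n F} := by
      rintro _ ⟨y, hy, rfl⟩
      exact hy
    exact hhull (convexHull_mono h₂ h₁)
  -- (2d) `V` is relatively open in the matrices with Hermitian family of places
  obtain ⟨S, hS⟩ := assembly_exists_submodule_placeFamily_isHermitian n K
  obtain ⟨O, hO, hRO⟩ := hOpen (InfinitePlace K) n c C τ
  have hR₀S : R₀ = (S : Set (Matrix (Fin n) (Fin n) (mixedSpace K))) ∩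
      SiegelFamily.placeFamily K ⁻¹' O := by
    ext H
    change SiegelFamily.placeFamily K H ∈ {F | SiegelFamily.IsReduced c C τ n F} ↔ _
    rw [hRO, hS]
    exact Iff.rfl
  obtain ⟨O', hO', hVO'⟩ :=
    assembly_convexHull_inter_relOpen S (hO.preimage (SiegelFamily.continuous_placeFamily n))
  have hVeq : V = (S : Set (Matrix (Fin n) (Fin n) (mixedSpace K))) ∩ O' := by rw [hV, hR₀S, hVO']
  have hXS : ∀ x : ↥C₀, (x : Matrix (Fin n) (Fin n) (mixedSpace K)) ∈
      (S : Set (Matrix (Fin n) (Fin n) (mixedSpace K))) := fun x => by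
    rw [hS]
    exact assembly_placeFamily_isHermitian_of_cone n K x.2.1 x.2.2
  -- the trace `V'` of `V` on the cone is open
  set V' : Set ↥C₀ := {x | (x : Matrix (Fin n) (Fin n) (mixedSpace K)) ∈ V} with hV'
  have hV'mem : ∀ x : ↥C₀, x ∈ V' ↔ (x : Matrix (Fin n) (Fin n) (mixedSpace K)) ∈ V :=
    fun _ => Iff.rfl
  have hV'open : IsOpen V' := by
    have he : V' = Subtype.val ⁻¹' O' := by
      ext x
      rw [hV'mem, hVeq]
      exact ⟨fun h => h.2, fun h => ⟨hXS x, h⟩⟩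
    rw [he]
    exact hO'.preimage continuous_subtype_val
  -- (3) the Siegel set `𝔖♯ = {h : h hᴴ ∈ V}` and the cover data
  set Sg : Set (GL (Fin n) (mixedSpace K)) :=
    {h | (h : Matrix (Fin n) (Fin n) (mixedSpace K)) *
      (h : Matrix (Fin n) (Fin n) (mixedSpace K))ᴴ ∈ V} with hSg
  have hO := SiegelCover.exists_cover_data_of_fundamentalSet_of_siegelProperty
    (X := ↥C₀) θ (globalEmbedding n K) U hUo hUc Sg (Kinf n K) x₀
    (fun g hg => Subtype.ext (by rw [hsmul_coe, hx₀, Matrix.mul_one]; exact (hstab g).2 hg))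
    (fun h hh => (hstab h).1 (by
      have := congrArg Subtype.val hh
      rwa [hsmul_coe, hx₀, Matrix.mul_one] at this))
    (fun x => by
      obtain ⟨g, hg⟩ := htrans x.1 x.2.1 x.2.2
      exact ⟨g, Subtype.ext (by rw [hsmul_coe, hx₀, Matrix.mul_one]; exact hg)⟩)
    ⟨Q₀, hQ₀, fun g => by
      obtain ⟨γ, hγ, b, hb, k', hk', hgbk⟩ := hcov₀ g
      exact ⟨γ, (hf_apply γ).symm ▸ hγ, b, subset_convexHull ℝ R₀ (hin b hb), k', hk', hgbk⟩⟩
    (fun Q hQ => by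
      refine (archSiegelProperty n K Ω' hΩ'B hΩ'inf hΩ'c t' ht' Q hQ).subset ?_
      rintro γ ⟨hγ, b, hb, b', hb', k', hk', hγb⟩
      obtain ⟨b₁, hb₁, hb₁b⟩ := hout _ (hVR₁ _ hb)
      obtain ⟨b₁', hb₁', hb₁b'⟩ := hout _ (hVR₁ _ hb')
      have hk₁ : b₁⁻¹ * b ∈ Kinf n K :=
        (hstab _).1 (assembly_mul_conjTranspose_eq_one_of_eq hb₁b.symm)
      have hk₁' : b₁'⁻¹ * b' ∈ Kinf n K :=
        (hstab _).1 (assembly_mul_conjTranspose_eq_one_of_eq hb₁b'.symm)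
      refine ⟨(hf_apply γ) ▸ hγ, b₁, hb₁, b₁', hb₁', b₁'⁻¹ * b' * k' * (b₁⁻¹ * b)⁻¹,
        mul_mem (mul_mem hk₁' hk') (inv_mem hk₁), ?_⟩
      rw [mul_inv_rev, inv_inv]
      calc θ γ * b₁ = θ γ * b * (b⁻¹ * b₁) := by rw [mul_assoc, mul_inv_cancel_left]
        _ = b' * k' * (b⁻¹ * b₁) := by rw [hγb]
        _ = b₁' * (b₁'⁻¹ * b' * k' * (b⁻¹ * b₁)) := by simp only [mul_assoc, mul_inv_cancel_left])
  obtain ⟨Q, hQc, hcovX, hfinX⟩ := hO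
  -- (4) the free `Γ_U`-set of indices `ι = {γ : γ_f ∈ U · Q}`; the action on the cone through `θ`
  let ι : Type := {γ : GL (Fin n) K // globalEmbedding n K γ ∈ (U : Set (FiniteAdelicGL n K)) * Q}
  letI instι : MulAction ↥(U.comap (globalEmbedding n K)) ι :=
    { smul := fun g i => ⟨g.1 * i.1, by
        obtain ⟨u, hu, q', hq', huq⟩ := Set.mem_mul.1 i.2
        refine Set.mem_mul.2 ⟨globalEmbedding n K g.1 * u, U.mul_mem g.2 hu, q', hq', ?_⟩
        rw [map_mul, ← huq, mul_assoc]⟩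
      one_smul := fun i => Subtype.ext (one_mul _)
      mul_smul := fun g g' i => Subtype.ext (mul_assoc _ _ _) }
  have coe_smul_index : ∀ (g : ↥(U.comap (globalEmbedding n K))) (i : ι),
      ((g • i : ι) : GL (Fin n) K) = g.1 * i.1 := fun _ _ => rfl
  letI instX : MulAction ↥(U.comap (globalEmbedding n K)) ↥C₀ :=
    MulAction.compHom ↥C₀ (θ.comp (U.comap (globalEmbedding n K)).subtype)
  have hΓsmul : ∀ (g : ↥(U.comap (globalEmbedding n K))) (x : ↥C₀), g • x = θ g.1 • x :=
    fun _ _ => rfl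
  -- the cover `W i = θ(i) • V` traced on the cone
  set W : ι → Set ↥C₀ := fun i => {x | (θ i.1)⁻¹ • x ∈ V'} with hW
  have hWmem : ∀ (i : ι) (x : ↥C₀), x ∈ W i ↔ (θ i.1)⁻¹ • x ∈ V' := fun _ _ => Iff.rfl
  -- (5) Brown's criterion in Čech form, finite coefficients, for the free equivariant good cover
  refine finite_groupCohomology_int_of_free_equivariantGoodCover (X := ↥C₀)
    (G := ↥(U.comap (globalEmbedding n K))) (ι := ι) W ?_ ?_ ?_ ?_ ?_ ?_ A hA q
  · -- the cover sets are open in the cone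
    intro i
    exact hV'open.preimage (hcont _)
  · -- they cover the cone (fundamental set)
    intro x _
    obtain ⟨γ, hγ, b, hb, hx⟩ := hcovX x
    refine Set.mem_iUnion.2 ⟨⟨γ, hγ⟩, ?_⟩
    rw [hWmem]
    change (θ γ)⁻¹ • x ∈ V'
    rw [← hx, inv_smul_smul, hV'mem, hsmul_coe, hx₀, Matrix.mul_one]
    exact hb
  · -- non-empty finite intersections are contractible (convexity)
    intro p J hJ
    have hT : Convex ℝ {M : Matrix (Fin n) (Fin n) (mixedSpace K) | ∀ l,
        (((θ (J l).1)⁻¹ : GL (Fin n) (mixedSpace K)) : Matrix (Fin n) (Fin n) (mixedSpace K)) * M *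
          (((θ (J l).1)⁻¹ : GL (Fin n) (mixedSpace K)) :
            Matrix (Fin n) (Fin n) (mixedSpace K))ᴴ ∈ V} := by
      rw [Set.setOf_forall]
      exact convex_iInter fun l =>
        (convex_convexHull ℝ R₀).is_linear_preimage (assembly_isLinearMap_act (θ (J l).1)⁻¹)
    have hce : cechSet W J = {x : ↥C₀ | (x : Matrix (Fin n) (Fin n) (mixedSpace K)) ∈
        {M : Matrix (Fin n) (Fin n) (mixedSpace K) | ∀ l,
          (((θ (J l).1)⁻¹ : GL (Fin n) (mixedSpace K)) : Matrix (Fin n) (Fin n) (mixedSpace K)) *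
            M * (((θ (J l).1)⁻¹ : GL (Fin n) (mixedSpace K)) :
              Matrix (Fin n) (Fin n) (mixedSpace K))ᴴ ∈ V}} := by
      ext x
      rw [mem_cechSet_iff]
      exact Iff.rfl
    rw [hce] at hJ ⊢
    obtain ⟨x, hx⟩ := hJ
    exact assembly_contractibleSpace_subtype_inter hconv hT ⟨x, hx⟩
  · -- equivariance `g • W i = W (g • i)`
    intro g i
    ext x
    constructor
    · rintro ⟨y, hy, rfl⟩
      change g • y ∈ W (g • i)
      rw [hWmem] at hy ⊢
      rw [coe_smul_index, map_mul, hΓsmul, mul_inv_rev, mul_smul, inv_smul_smul]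
      exact hy
    · intro hx
      rw [hWmem, coe_smul_index, map_mul, mul_inv_rev, mul_smul] at hx
      refine ⟨g⁻¹ • x, ?_, smul_inv_smul g x⟩
      rw [hWmem, hΓsmul, Subgroup.coe_inv, map_inv]
      exact hx
  · -- the action on indices is free
    intro g i hgi
    have h := congrArg Subtype.val hgi
    rw [coe_smul_index] at h
    exact Subtype.ext (mul_eq_right.1 h |>.symm ▸ rfl)
  · -- finitely many orbits of nerve simplices (Siegel property)
    intro p
    obtain ⟨S₀, hS₀, hrep⟩ := hfinX p
    refine ⟨{J₀ : Fin (p + 1) → ι | (fun l => (J₀ l).1) ∈ S₀}, ?_, ?_⟩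
    · refine hS₀.preimage ?_
      intro J₁ _ J₂ _ hJ
      funext l
      exact Subtype.ext (congrFun hJ l)
    · intro J hJ
      obtain ⟨x, hx⟩ := hJ
      rw [mem_cechSet_iff] at hx
      have hx' : ∃ x : ↥C₀, ∀ l, ∃ b ∈ Sg, θ (J l).1 • b • x₀ = x := by
        refine ⟨x, fun l => ?_⟩
        have hl := hx l
        rw [hWmem, hV'mem] at hl
        -- the point `θ(J l)⁻¹ • x` of `V ⊆ C₀` is `b bᴴ = b • x₀` (transitivity), and `b ∈ 𝔖♯`
        obtain ⟨b, hb⟩ := htrans _ (hVC₀ hl).1 (hVC₀ hl).2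
        have hy : b • x₀ = (θ (J l).1)⁻¹ • x :=
          Subtype.ext (by rw [hsmul_coe, hx₀, Matrix.mul_one]; exact hb)
        refine ⟨b, ?_, by rw [hy, smul_inv_smul]⟩
        change (b : Matrix (Fin n) (Fin n) (mixedSpace K)) *
          (b : Matrix (Fin n) (Fin n) (mixedSpace K))ᴴ ∈ V
        rw [hb]
        exact hl
      obtain ⟨J₀, hJ₀, g, hg, hgJ⟩ := hrep (fun l => (J l).1) (fun l => (J l).2) hx'
      have hmem : ∀ l, globalEmbedding n K (J₀ l) ∈ (U : Set (FiniteAdelicGL n K)) * Q := by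
        intro l
        obtain ⟨u, hu, q', hq', huq⟩ := Set.mem_mul.1 (J l).2
        refine Set.mem_mul.2 ⟨(globalEmbedding n K g)⁻¹ * u, U.mul_mem (U.inv_mem hg) hu,
          q', hq', ?_⟩
        have hk : J₀ l = g⁻¹ * (J l).1 := by rw [← hgJ l, inv_mul_cancel_left]
        rw [hk, map_mul, map_inv, mul_assoc, huq]
      refine ⟨fun l => ⟨J₀ l, hmem l⟩, hJ₀, ⟨g, hg⟩, ?_⟩
      funext l
      exact Subtype.ext (hgJ l)

end Literature.NumberTheory.Automorphic.BorelSerre1973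

end Part1

/-!
## Part 2 — port of `Summits/Langlands/Langlands/Theorems/IrreducibilityBySelfDualityHeckeEigenvalueFieldStubModuleFiniteGoodCover.lean`

# Brown's finiteness criterion from an equivariant good cover — finitely generated coefficients
#

This is the purely homological-algebra input
of the Borel–Serre finite-dimensionality of `H^q(Γ_U, A)` for congruence subgroups `Γ_U` with
coefficients a finitely generated representation over a Noetherian ring `k` (for `k` a field:
finite-dimensional): the verbatim twin of the tree's
`Literature.Algebra.Homology.finite_groupCohomology_of_free_equivariantGoodCover`
(`Literature/Algebra/Homology/GroupCohomologyEquivariantGoodCover`) with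
"`A` has finitely many elements ⇒ `Hⁿ(G, A)` finite" replaced by
"`A` finitely generated over a Noetherian `k` ⇒ `Hⁿ(G, A)` finitely generated over `k`".

Let a group `G` act on a CONTRACTIBLE space `X` and on an index set `ι`, and let
`𝔘 = (U_i)_{i ∈ ι}` be an open cover with `g U_i = U_{g i}` all of whose non-empty finite
intersections are contractible, the action on `ι` FREE and with finitely many `G`-orbits of
`p`-simplices of the nerve `N_p(𝔘)` for each `p`.  Then for every `A : Rep k G` finitely
generated over the Noetherian ring `k`, every `Hⁿ(G, A)` is finitely generated over `k`
(`moduleFinite_groupCohomology_of_free_equivariantGoodCover`, universe-polymorphic;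
`moduleFinite_goodCover`, the registered `Type` instance).  The chain is the tree's, with
`Finite` replaced by `Module.Finite k`:

* `moduleFinite_groupCohomology_zero_of_shortExact`, `moduleFinite_groupCohomology_of_coresolution`
  — dimension shifting along a coresolution cut into short exact pieces
  (`H⁰(G, Z a) ↪ H⁰(G, W a)`, Mathlib `groupCohomology.mono_map_0_of_mono`, and the tree's
  `moduleFinite_groupCohomology_succ_of_shortExact`);
* `moduleFinite_groupCohomology_of_exact_sequence` — the same for an exact sequence
  `0 → A → W 0 → W 1 → ⋯` (kernels as subrepresentations);
* `moduleFinite_groupCohomology_funRep_of_free` — `Hⁿ(G, Fun(Y, A))` for a free `G`-set `Y` with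
  finitely many orbits, by `Fun(Y, A) ≅ Coind_1^G Fun(T, A)` (`funRepIsoCoind`) and Shapiro's
  lemma (Mathlib `groupCohomology.coindIso`);
* `moduleFinite_groupCohomology_of_invariantGoodCover` — the exact Čech coresolution
  `0 → A → Fun(N₀, A) → Fun(N₁, A) → ⋯` (`cechFunCoaug_injective`, `cechFunCoaug_exact`,
  `cechFunD_exact_succ`, Leray) in `Rep k G` (`cechRepD`);
* `moduleFinite_groupCohomology_of_free_equivariantGoodCover` — the nerve is a free `G`-set with
  finitely many orbits in each degree (`Nerve.eq_one_of_smul_eq`, `Nerve.finite_orbitRelQuotient`,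
  `bijective_smul_out`).

## References

* K. S. Brown, *Cohomology of Groups*, GTM 87 (1982), III §7, III (6.2), VII §4, VII (7.10),
  VIII §2 [Brown1982CohomologyGroups].
* A. Borel, J.-P. Serre, *Corners and arithmetic groups*, Comment. Math. Helv. 48 (1973), §11.1
  [BorelSerre1973].
-/

section Part2

namespace Literature.NumberTheory.Automorphic.BorelSerre1973

open _root_.CategoryTheory groupCohomology
open Literature.Algebra.Homology
open Literature.AlgebraicTopology.SingularHomology
open Literature.AlgebraicTopology.SingularHomology.CechNerve
open scoped _root_.Pointwise

universe u

section Polymorphic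

variable {k G : Type u} [CommRing k] [Group G] [IsNoetherianRing k]

/-! ### Dimension shifting along a coresolution -/

/-- **Degree `0`**: for a short exact sequence `0 → X₁ → X₂ → X₃ → 0` of representations over a
Noetherian ring `k`, `H⁰(G, X₁) ↪ H⁰(G, X₂)` (Mathlib `groupCohomology.mono_map_0_of_mono`), so
`H⁰(G, X₁)` is finitely generated when `H⁰(G, X₂)` is (a submodule of a finitely generated module
over a Noetherian ring). [cite: Brown1982CohomologyGroups, VII (7.10); VIII §2 (Brown's finiteness criterion in Čech form, Module.Finite version)] -/
theorem moduleFinite_groupCohomology_zero_of_shortExact {X : ShortComplex (Rep k G)}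
    (hX : X.ShortExact) (h₂ : Module.Finite k (groupCohomology X.X₂ 0)) :
    Module.Finite k (groupCohomology X.X₁ 0) := by
  haveI := hX.mono_f
  haveI := h₂
  exact Module.Finite.of_injective (map (MonoidHom.id G) X.f 0).hom
    ((ModuleCat.mono_iff_injective (map (MonoidHom.id G) X.f 0)).1 inferInstance)

section Coresolution

variable (Z W : ℕ → Rep k G) (ι : ∀ a, Z a ⟶ W a) (π : ∀ a, W a ⟶ Z (a + 1))
  (w : ∀ a, ι a ≫ π a = 0) (hex : ∀ a, (ShortComplex.mk (ι a) (π a) (w a)).ShortExact)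

include hex in
/-- **Finite generation propagates along a coresolution.**  Let `Z 0 → W 0 → W 1 → ⋯` be a
coresolution in `Rep k G` (`k` Noetherian) presented by short exact pieces
`0 → Z a → W a → Z (a+1) → 0`.  If every `Hᵇ(G, W a)` is finitely generated over `k` then every
`Hᵇ(G, Z a)` is: induction on `b` for all `a` at once, using `H⁰(G, Z a) ↪ H⁰(G, W a)` and the
exact segments `Hᵇ(G, Z (a+1)) → Hᵇ⁺¹(G, Z a) → Hᵇ⁺¹(G, W a)`
(`moduleFinite_groupCohomology_succ_of_shortExact`).  (Finiteness half of Brown's criterion,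
VII (7.10), by dimension shifting instead of the spectral sequence.)
[cite: Brown1982CohomologyGroups, VII (7.10); III §7] -/
theorem moduleFinite_groupCohomology_of_coresolution
    (hW : ∀ a b, Module.Finite k (groupCohomology (W a) b)) :
    ∀ b a, Module.Finite k (groupCohomology (Z a) b) := by
  intro b
  induction b with
  | zero =>
    intro a
    exact moduleFinite_groupCohomology_zero_of_shortExact (hex a) (hW a 0)
  | succ b ih =>
    intro a
    exact moduleFinite_groupCohomology_succ_of_shortExact (hex a) b (ih (a + 1)) (hW a (b + 1))

include hex in
/-- **Corollary (the abutment).**  Under the hypotheses of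
`moduleFinite_groupCohomology_of_coresolution`, `Hᵇ(G, Z 0)` is finitely generated for every `b`.
[cite: Brown1982CohomologyGroups, VII (7.10)] -/
theorem moduleFinite_groupCohomology_of_coresolution_zero
    (hW : ∀ a b, Module.Finite k (groupCohomology (W a) b)) (b : ℕ) :
    Module.Finite k (groupCohomology (Z 0) b) :=
  moduleFinite_groupCohomology_of_coresolution Z W ι π w hex hW b 0

end Coresolution

/-- **Finitely generated group cohomology from an exact coresolution.**  Let
`0 → A —ε→ W 0 —d₀→ W 1 —d₁→ ⋯` be an exact sequence in `Rep k G` (`k` Noetherian; `ε` injective,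
`im ε = ker d₀`, `im d_a = ker d_{a+1}`).  If `Hᵇ(G, W a)` is finitely generated for all `a, b`,
then `Hᵇ(G, A)` is finitely generated for all `b` (cut into `0 → ker d_a → W a → ker d_{a+1} → 0`
and apply `moduleFinite_groupCohomology_of_coresolution`; `A ≅ ker d₀`).
[cite: Brown1982CohomologyGroups, VII (7.10); III §7] -/
theorem moduleFinite_groupCohomology_of_exact_sequence (A : Rep k G) (W : ℕ → Rep k G)
    (ε : A ⟶ W 0) (d : ∀ a, W a ⟶ W (a + 1))
    (hε : Function.Injective ε.hom) (h₀ : Function.Exact ε.hom (d 0).hom)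
    (hd : ∀ a, Function.Exact (d a).hom (d (a + 1)).hom)
    (hW : ∀ a b, Module.Finite k (groupCohomology (W a) b)) (b : ℕ) :
    Module.Finite k (groupCohomology A b) := by
  -- the kernels `Z a = ker d_a` as subrepresentations
  let K : ∀ a, Submodule k (W a) := fun a => LinearMap.ker (d a).hom.toLinearMap
  have hK : ∀ a g, K a ≤ (K a).comap ((W a).ρ g) := fun a g => ker_le_comap_of_hom (d a) g
  let Z : ℕ → Rep k G := fun a => Rep.subrepresentation (W a) (K a) (hK a)
  let ι : ∀ a, Z a ⟶ W a := fun a => Rep.subtype (W a) (K a) (hK a)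
  have hdd : ∀ a (x : W a), (d (a + 1)).hom ((d a).hom x) = 0 := fun a x =>
    (hd a ((d a).hom x)).2 ⟨x, rfl⟩
  -- the corestrictions `W a ↠ Z (a+1)` of `d_a`
  let π : ∀ a, W a ⟶ Z (a + 1) := fun a =>
    Rep.ofHom
      { toLinearMap := LinearMap.codRestrict (K (a + 1)) (d a).hom.toLinearMap fun x => by
          change (d (a + 1)).hom ((d a).hom x) = 0
          exact hdd a x
        isIntertwining' := fun g => by
          refine LinearMap.ext fun x => Subtype.ext ?_
          exact Rep.hom_comm_apply (d a) g x }
  have hπ : ∀ a (x : W a), ((π a).hom x : W (a + 1)) = (d a).hom x := fun a x => rfl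
  have w : ∀ a, ι a ≫ π a = 0 := fun a => by
    refine Rep.hom_ext (Representation.IntertwiningMap.ext (LinearMap.ext fun x => ?_))
    apply Subtype.ext
    change (d a).hom ((ι a).hom x) = 0
    exact x.2
  have hex : ∀ a, (ShortComplex.mk (ι a) (π a) (w a)).ShortExact := fun a => by
    refine shortExact_of_function_exact _ ?_ ?_ ?_
    · exact Subtype.val_injective
    · intro y
      obtain ⟨x, hx⟩ := (hd a (y : W (a + 1))).1 y.2
      exact ⟨x, Subtype.ext hx⟩
    · intro x
      change (π a).hom x = 0 ↔ x ∈ Set.range (ι a).hom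
      constructor
      · intro hx
        have hx' : (d a).hom x = 0 := by rw [← hπ, hx]; rfl
        exact ⟨⟨x, hx'⟩, rfl⟩
      · rintro ⟨z, rfl⟩
        exact Subtype.ext z.2
  have hZ : Module.Finite k (groupCohomology (Z 0) b) :=
    moduleFinite_groupCohomology_of_coresolution_zero Z W ι π w hex hW b
  -- `A ≅ Z 0`
  let φ : A ⟶ Z 0 :=
    Rep.ofHom
      { toLinearMap := LinearMap.codRestrict (K 0) ε.hom.toLinearMap fun x => by
          change (d 0).hom (ε.hom x) = 0
          exact (h₀ (ε.hom x)).2 ⟨x, rfl⟩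
        isIntertwining' := fun g => by
          refine LinearMap.ext fun x => Subtype.ext ?_
          exact Rep.hom_comm_apply ε g x }
  have hφ : Function.Bijective φ.hom := by
    constructor
    · intro x y hxy
      exact hε (congrArg Subtype.val hxy)
    · intro z
      obtain ⟨x, hx⟩ := (h₀ (z : W 0)).1 z.2
      exact ⟨x, Subtype.ext hx⟩
  haveI : IsIso ((forget (Rep k G)).map φ) := (isIso_iff_bijective _).2 hφ
  haveI : IsIso φ := isIso_of_reflects_iso φ (forget (Rep k G))
  exact (Module.Finite.equiv_iff
    ((groupCohomology.functor k G b).mapIso (asIso φ)).toLinearEquiv).2 hZ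

/-! ### Functions on a free `G`-set with finitely many orbits -/

/-- **`Hⁿ(G, Fun(Y, A))` is finitely generated for a free `G`-set `Y` with finitely many orbits
and `A` finitely generated over the Noetherian ring `k`**:
`Hⁿ(G, Fun(Y, A)) ≅ Hⁿ(G, Coind_1^G Fun(T, A)) ≅ Hⁿ(1, Fun(T, A))` (`funRepIsoCoind` and Shapiro's
lemma, Mathlib `groupCohomology.coindIso`), which is `0` for `n ≥ 1`
(`isZero_groupCohomology_succ_of_subsingleton`) and the invariants `Fun(T, A)¹ ⊆ Fun(T, A)`, a
finitely generated module for `T` finite, for `n = 0`.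
[cite: Brown1982CohomologyGroups, III (6.2) Shapiro's lemma] -/
theorem moduleFinite_groupCohomology_funRep_of_free (A : Rep.{u} k G) (Y : Type u)
    [MulAction G Y] {T : Type u} (t : T → Y)
    (hbij : Function.Bijective fun p : G × T => p.1 • t p.2) [Finite T] [Module.Finite k A]
    (n : ℕ) : Module.Finite k (groupCohomology (funRep A Y) n) := by
  have e := ((groupCohomology.functor k G n).mapIso (funRepIsoCoind A Y t hbij)).toLinearEquiv
  have h₁ : Module.Finite k (groupCohomology (orbitCoeff (k := k) A T) n) := by
    cases n with
    | zero =>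
      haveI : Module.Finite k (orbitCoeff (k := k) A T) :=
        inferInstanceAs (Module.Finite k (T → A))
      exact moduleFinite_groupCohomology_zero _
    | succ m =>
      haveI := ModuleCat.subsingleton_of_isZero
        (isZero_groupCohomology_succ_of_subsingleton (orbitCoeff (k := k) A T) m)
      infer_instance
  -- Shapiro's lemma `Hⁿ(G, Coind_1^G Fun(T, A)) ≅ Hⁿ(1, Fun(T, A))`
  have hc := (Module.Finite.equiv_iff
    (groupCohomology.coindIso (orbitCoeff (k := k) A T) n).toLinearEquiv).2 h₁
  exact (Module.Finite.equiv_iff e).2 hc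

/-! ### The finiteness criterion -/

/-- **Brown's finiteness criterion from an invariant good cover, finitely generated
coefficients.**  Let `G` act by homeomorphisms on a contractible space `X` covered by an invariant
family of open sets all of whose non-empty finite intersections are contractible.  If
`Hⁿ(G, Fun(N_p(𝔘), A))` is finitely generated over the Noetherian ring `k` for all `p, n`, then
`Hⁿ(G, A)` is finitely generated for all `n`: the Čech complex
`0 → A → Fun(N₀, A) → Fun(N₁, A) → ⋯` is an exact coresolution in `Rep k G`
(`cechFunCoaug_injective`, `cechFunCoaug_exact`, `cechFunD_exact_succ`), and dimension shifting
applies (`moduleFinite_groupCohomology_of_exact_sequence`).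
[cite: Brown1982CohomologyGroups, VII (7.10); VII §4] -/
theorem moduleFinite_groupCohomology_of_invariantGoodCover {X : Type u} [MulAction G X]
    {ι : Type u} [MulAction G ι] (U : ι → Set X) [IsInvariantFamily G U] (A : Rep.{u} k G)
    [TopologicalSpace X] [ContractibleSpace X]
    (hU : ∀ i, IsOpen (U i)) (hcov : (Set.univ : Set X) ⊆ ⋃ i, U i)
    (hgood : ∀ (p : ℕ) (J : Fin (p + 1) → ι), (cechSet U J).Nonempty →
      ContractibleSpace ↥(cechSet U J))
    (hW : ∀ p n, Module.Finite k (groupCohomology (funRep A (Nerve U p)) n)) (n : ℕ) :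
    Module.Finite k (groupCohomology A n) := by
  haveI : Nonempty X := inferInstance
  exact moduleFinite_groupCohomology_of_exact_sequence A (fun p => funRep A (Nerve U p))
    (funRepConst A (Nerve U 0)) (fun p => cechRepD U A p)
    (cechFunCoaug_injective (R := k) (M := A) (U := U) hcov)
    (cechFunCoaug_exact (R := k) (M := A) (U := U) hU hcov)
    (fun p => cechFunD_exact_succ (R := k) (M := A) (U := U) hU hcov hgood p) hW n

omit [IsNoetherianRing k] in
/-- **Brown's finiteness criterion from an equivariant good cover indexed by a free `G`-set with
finitely many orbits of simplices — finitely generated coefficients over a Noetherian ring.**  Let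
`G` act on a contractible space `X` covered by open sets `U_i` indexed by a FREE `G`-set `ι`, with
`g U_i = U_{g i}`, all non-empty finite intersections contractible, and finitely many `G`-orbits
of `p`-simplices of the nerve for each `p`.  Then `Hⁿ(G, A)` is finitely generated over `k` for
every representation `A` finitely generated over the Noetherian ring `k`: the nerve is a free
`G`-set with finitely many orbits in each degree, decomposed as `G × N_p/G ≃ N_p` by the section
`Quotient.out` (`bijective_smul_out`), so `Hⁿ(G, Fun(N_p, A))` is finitely generated
(`moduleFinite_groupCohomology_funRep_of_free`), and the exact Čech coresolution gives the claim
by dimension shifting (`moduleFinite_groupCohomology_of_invariantGoodCover`).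
[cite: Brown1982CohomologyGroups, VII (7.10); VIII §2] -/
theorem moduleFinite_groupCohomology_of_free_equivariantGoodCover
    {X : Type u} [TopologicalSpace X] [ContractibleSpace X]
    {ι : Type u} [MulAction G ι] [MulAction G X]
    (U : ι → Set X) (hUo : ∀ i, IsOpen (U i)) (hcov : Set.univ ⊆ ⋃ i, U i)
    (hgood : ∀ (p : ℕ) (J : Fin (p + 1) → ι),
      (cechSet U J).Nonempty → ContractibleSpace ↥(cechSet U J))
    (hUG : ∀ (g : G) (i : ι), (fun x : X => g • x) '' U i = U (g • i))
    (hfree : ∀ (g : G) (i : ι), g • i = i → g = 1)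
    (hfin : ∀ p : ℕ, ∃ S : Set (Fin (p + 1) → ι), S.Finite ∧
      ∀ J : Fin (p + 1) → ι, (cechSet U J).Nonempty → ∃ J₀ ∈ S, ∃ g : G, g • J₀ = J)
    [IsNoetherianRing k] (A : Rep.{u} k G) [Module.Finite k A] (n : ℕ) :
    Module.Finite k (groupCohomology A n) := by
  haveI : IsInvariantFamily G U := isInvariantFamily_of_image_eq U hUG
  refine moduleFinite_groupCohomology_of_invariantGoodCover U A hUo hcov hgood (fun p m => ?_) n
  obtain ⟨S, hS, hSN⟩ := hfin p
  haveI := Nerve.finite_orbitRelQuotient (G := G) U hS hSN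
  -- `bijective_smul_out` decomposes a free `G`-set as `N_p/G × G`; swap the factors.
  exact moduleFinite_groupCohomology_funRep_of_free A (Nerve U p)
    (fun a : MulAction.orbitRel.Quotient G (Nerve U p) => a.out)
    ((bijective_smul_out (Nerve.eq_one_of_smul_eq U hfree p)).comp Prod.swap_bijective) m

end Polymorphic

/-! ### the theorem (all types in `Type`) -/

/-- **M — Brown's finiteness criterion in Čech form, `Module.Finite` version** (twin of the `finite_groupCohomology_of_free_equivariantGoodCover` with "finitely many elements" replaced by
"finitely generated over a Noetherian coefficient ring"): a group acting on a contractible space with an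
equivariant open good cover indexed by a free `G`-set with finitely many orbits of nerve simplices has
`Hⁿ(G, A)` finitely generated for `A` finitely generated. [cite: Brown1982CohomologyGroups, VII (7.10); VIII §2] -/
theorem moduleFinite_goodCover :
    ∀ {X : Type} [TopologicalSpace X] [ContractibleSpace X]
      {G : Type} [Group G] {ι : Type} [MulAction G ι] [MulAction G X]
      (U : ι → Set X), (∀ i, IsOpen (U i)) → (Set.univ ⊆ ⋃ i, U i) →
      (∀ (p : ℕ) (J : Fin (p + 1) → ι),
        (Literature.AlgebraicTopology.SingularHomology.cechSet U J).Nonempty →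
          ContractibleSpace ↥(Literature.AlgebraicTopology.SingularHomology.cechSet U J)) →
      (∀ (g : G) (i : ι), (fun x : X => g • x) '' U i = U (g • i)) →
      (∀ (g : G) (i : ι), g • i = i → g = 1) →
      (∀ p : ℕ, ∃ S : Set (Fin (p + 1) → ι), S.Finite ∧
        ∀ J : Fin (p + 1) → ι,
          (Literature.AlgebraicTopology.SingularHomology.cechSet U J).Nonempty →
            ∃ J₀ ∈ S, ∃ g : G, g • J₀ = J) →
      ∀ {k : Type} [CommRing k] [IsNoetherianRing k] (A : Rep k G) [Module.Finite k A] (q : ℕ),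
        Module.Finite k (groupCohomology A q) := by
  intro X _ _ G _ ι _ _ U hUo hcov hgood hUG hfree hfin k _ _ A _ q
  exact moduleFinite_groupCohomology_of_free_equivariantGoodCover U hUo hcov hgood hUG hfree hfin A q

end Literature.NumberTheory.Automorphic.BorelSerre1973

end Part2

/-!
## Part 3 — port of `Summits/Langlands/Langlands/Theorems/IrreducibilityBySelfDualityHeckeEigenvalueFieldStubAssembly.lean`

# Borel–Serre finite-dimensionality for congruence subgroups of `GL_n` — the assembly
#

For a number field `K`, a compact open
`U ≤ GL_n(𝔸_K^∞)`, the congruence subgroup `Γ_U = GL_n(K) ∩ U` and a finite-dimensional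
representation `A` of `Γ_U` over a field `k`, every `H^q(Γ_U, A)` is finite-dimensional
([BorelSerre1973, §11.1, Thm. 11.4.4]).  This part proves the theorem
`borelSerre_assembly`: the theorem GIVEN the Hull Lemma (`hHull`), the relative openness
(`hOpen`) and positivity (`hPos`) of Siegel-reduced families, and the two halves of the sandwich of
the archimedean Siegel domain between reduced families (`hIn`, `hOut`), from the four inputs
`moduleFinite_goodCover` (Brown's criterion in Čech form), `coneModel` (the cone of
positive forms over `K ⊗ ℝ`), `archFundamentalSet` and `archSiegelProperty` (reduction
theory in archimedean form).  It is the all-`(n, K)` version of the Bianchi proof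
`BianchiCongruenceCohomologyFinite_proof`.

Proof.  `Γ_U` acts through `θ = GL_n(mixedEmbedding K)` on the contractible cone
`X ⊆ M_n(K ⊗ ℝ)` of matrices positive definite at every place, by `g • H = g H gᴴ`
(`coneModel`: transitive, stabiliser of `1` equal to `K_∞`, convex).  The prototype open set is
the CONVEX HULL `V = conv R₀` of the set `R₀` of matrices with `(c, C, τ)`-reduced family of places,
the constants being those of sandwich-in for Borel's fundamental set (`archFundamentalSet`):
`V` lies in the cone (`hPos`), in the `(c', C', τ')`-reduced matrices (`hHull`), hence in the image
`𝔖' • 1` of a second archimedean Siegel set (`hOut`), and it is relatively open in the self-adjoint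
matrices (`hOpen` and `assembly_convexHull_inter_relOpen`), so that its trace on the cone is open.
With the Siegel set `𝔖♯ = {h : h hᴴ ∈ V}` the fundamental-set property holds by sandwich-in and
the Siegel property by `archSiegelProperty` for `𝔖'`; hence
(`SiegelCover.exists_cover_data_of_fundamentalSet_of_siegelProperty`) the translates `θ(γ) • V`,
`γ_f ∈ U Q`, form a `Γ_U`-equivariant open cover of `X` indexed by a free `Γ_U`-set with finitely
many orbits of nerve simplices, whose non-empty finite intersections are convex, hence
contractible.  Brown's criterion (`moduleFinite_goodCover`) concludes.

## References

* A. Borel, J.-P. Serre, *Corners and arithmetic groups*, Comment. Math. Helv. 48 (1973), §11.1,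
  Thm. 11.4.4 [BorelSerre1973].
* K. S. Brown, *Cohomology of Groups*, GTM 87 (1982), VII (7.10), VIII §2
  [Brown1982CohomologyGroups].
* A. Borel, *Introduction aux groupes arithmétiques*, Hermann (1969), §13, §15 [Borel1969].
-/

section Part3

open scoped _root_.Classical _root_.Pointwise ComplexOrder _root_.Matrix
open _root_.Filter _root_.NumberField NumberField.mixedEmbedding _root_.IsDedekindDomain _root_.CategoryTheory
open Literature.NumberTheory.Automorphic Literature.Algebra.Homology
open Literature.AlgebraicTopology.SingularHomology

namespace Literature.NumberTheory.Automorphic.BorelSerre1973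

open BigHeckeGLn

/-- **ASSEMBLY — Borel–Serre finite-dimensionality of `H^q(Γ_U, A)` for congruence subgroups
of `GL_n` over a number field, from the Hull Lemma, the relative openness and positivity of reduced
families, the sandwich of the archimedean Siegel domain, and the inputs above** (Brown's criterion
in Čech form for the cover of the cone of positive forms over `K ⊗ ℝ` by the `Γ_U`-translates of the
convex hull of the reduced matrices: free index set `{γ : γ_f ∈ U Q}`, finitely many orbits of
nerve simplices by the fundamental set and the Siegel property, contractible intersections by
convexity).
[cite: BorelSerre1973, §11.1, Thm. 11.4.4] [cite: Brown1982CohomologyGroups, VII (7.10); VIII §2]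
[cite: Borel1969, §13 and §15] -/
theorem borelSerre_assembly
    (hHull : ∀ (ι : Type) (m : ℕ) (c C τ : ℝ), ∃ c' C' τ' : ℝ,
      convexHull ℝ {H : ι → Matrix (Fin m) (Fin m) ℂ | SiegelFamily.IsReduced c C τ m H} ⊆
        {H | SiegelFamily.IsReduced c' C' τ' m H})
    (hOpen : ∀ (ι : Type) [Finite ι] (m : ℕ) (c C τ : ℝ), ∃ O : Set (ι → Matrix (Fin m) (Fin m) ℂ),
      IsOpen O ∧ {H | SiegelFamily.IsReduced c C τ m H} = {H | ∀ w, (H w).IsHermitian} ∩ O)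
    (hPos : (∀ (ι : Type) (m : ℕ) (c C τ : ℝ) (H : ι → Matrix (Fin m) (Fin m) ℂ),
        SiegelFamily.IsReduced c C τ m H → ∀ w, (H w).PosDef) ∧
      (∀ (n : ℕ) (K : Type) [Field K] [NumberField K] (c C τ : ℝ)
        (H : Matrix (Fin n) (Fin n) (mixedSpace K)),
        SiegelFamily.IsReduced c C τ n (SiegelFamily.placeFamily K H) →
          (∀ w, (H.map (mixedSpaceEvalReal K w)).PosDef) ∧
            ∀ w, (H.map (mixedSpaceEvalComplex K w)).PosDef))
    (hIn : ∀ (n : ℕ) (K : Type) [Field K] [NumberField K]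
      (Ω : Set (GL (Fin n) (AdeleRing (𝓞 K) K))),
      Ω ⊆ (standardParabolicGL (AdeleRing (𝓞 K) K) (id : Fin n → Fin n) :
        Set (GL (Fin n) (AdeleRing (𝓞 K) K))) →
      Ω ⊆ Set.range (GLn.ofInfinite n K) → IsCompact (closure Ω) → ∀ (t : ℝ), 0 < t →
      ∃ c C τ : ℝ, ∀ b ∈ GLn.toMixed n K ''
          (((posRealScalar n K).range : Set (GL (Fin n) (AdeleRing (𝓞 K) K))) * Ω * siegelCone n K t),
        SiegelFamily.IsReduced c C τ n (SiegelFamily.placeFamily K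
          ((b : Matrix (Fin n) (Fin n) (mixedSpace K)) * (b : Matrix (Fin n) (Fin n) (mixedSpace K))ᴴ)))
    (hOut : ∀ (n : ℕ) (K : Type) [Field K] [NumberField K] (c C τ : ℝ),
      ∃ (Ω : Set (GL (Fin n) (AdeleRing (𝓞 K) K))) (t : ℝ), 0 < t ∧
        Ω ⊆ (standardParabolicGL (AdeleRing (𝓞 K) K) (id : Fin n → Fin n) :
          Set (GL (Fin n) (AdeleRing (𝓞 K) K))) ∧
        Ω ⊆ Set.range (GLn.ofInfinite n K) ∧ IsCompact (closure Ω) ∧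
        ∀ H : Matrix (Fin n) (Fin n) (mixedSpace K),
          SiegelFamily.IsReduced c C τ n (SiegelFamily.placeFamily K H) →
            ∃ b ∈ GLn.toMixed n K ''
                (((posRealScalar n K).range : Set (GL (Fin n) (AdeleRing (𝓞 K) K))) * Ω *
                  siegelCone n K t),
              (b : Matrix (Fin n) (Fin n) (mixedSpace K)) *
                (b : Matrix (Fin n) (Fin n) (mixedSpace K))ᴴ = H) :
    ∀ (k : Type) [Field k] (n : ℕ) (K : Type) [Field K] [NumberField K]
      (U : Subgroup (FiniteAdelicGL n K)),
      IsOpen (U : Set (FiniteAdelicGL n K)) → IsCompact (U : Set (FiniteAdelicGL n K)) →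
      ∀ (A : Rep k (U.comap (globalEmbedding n K))), Module.Finite k A →
        ∀ q : ℕ, Module.Finite k (groupCohomology A q) := by
  intro k _ n K _ _ U hUo hUc A hA q
  classical
  haveI : Module.Finite k A := hA
  -- (0) the cone model: `E = M_n(K ⊗ ℝ)`, the cone `C₀`, the action `g • H = g H gᴴ`, `x₀ = 1`
  obtain ⟨htrans, hstab, hinv, hconv⟩ := coneModel n K
  set C₀ : Set (Matrix (Fin n) (Fin n) (mixedSpace K)) :=
    {H | (∀ w, (H.map (mixedSpaceEvalReal K w)).PosDef) ∧
      ∀ w, (H.map (mixedSpaceEvalComplex K w)).PosDef} with hC₀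
  letI instGL : MulAction (GL (Fin n) (mixedSpace K)) ↥C₀ :=
    { smul := fun g x => ⟨(g : Matrix (Fin n) (Fin n) (mixedSpace K)) * x *
          (g : Matrix (Fin n) (Fin n) (mixedSpace K))ᴴ, hinv g x.1 x.2.1 x.2.2⟩
      one_smul := fun x => Subtype.ext (by
        change ((1 : GL (Fin n) (mixedSpace K)) : Matrix (Fin n) (Fin n) (mixedSpace K)) * x *
          ((1 : GL (Fin n) (mixedSpace K)) : Matrix (Fin n) (Fin n) (mixedSpace K))ᴴ = x
        rw [Units.val_one, Matrix.conjTranspose_one, Matrix.one_mul, Matrix.mul_one])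
      mul_smul := fun g h x =>
        Subtype.ext (assembly_act_mul g h (x : Matrix (Fin n) (Fin n) (mixedSpace K))) }
  have hsmul_coe : ∀ (g : GL (Fin n) (mixedSpace K)) (x : ↥C₀),
      ((g • x : ↥C₀) : Matrix (Fin n) (Fin n) (mixedSpace K)) =
        (g : Matrix (Fin n) (Fin n) (mixedSpace K)) * x *
          (g : Matrix (Fin n) (Fin n) (mixedSpace K))ᴴ :=
    fun _ _ => rfl
  have hcont : ∀ g : GL (Fin n) (mixedSpace K), Continuous fun x : ↥C₀ => g • x := fun g =>
    ((assembly_continuous_act g).comp continuous_subtype_val).subtype_mk _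
  haveI : ContractibleSpace ↥C₀ := hconv.contractibleSpace ⟨1, assembly_one_mem_cone n K⟩
  set x₀ : ↥C₀ := ⟨1, assembly_one_mem_cone n K⟩ with hx₀
  set θ : GL (Fin n) K →* GL (Fin n) (mixedSpace K) :=
    Matrix.GeneralLinearGroup.map (mixedEmbedding K) with hθ
  have hf_apply : ∀ γ, globalEmbedding n K γ =
      Matrix.GeneralLinearGroup.map (algebraMap K (FiniteAdeleRing (𝓞 K) K)) γ := fun γ => rfl
  -- (1) the constants: fundamental set, sandwich-in, hull, sandwich-out
  obtain ⟨Ω, t, ht, hΩB, hΩinf, hΩc, Q₀, hQ₀, hcov₀⟩ := archFundamentalSet n K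
  obtain ⟨c, C, τ, hin⟩ := hIn n K Ω hΩB hΩinf hΩc t ht
  obtain ⟨c', C', τ', hhull⟩ := hHull (InfinitePlace K) n c C τ
  obtain ⟨Ω', t', ht', hΩ'B, hΩ'inf, hΩ'c, hout⟩ := hOut n K c' C' τ'
  -- (2) the prototype `V = conv R₀`
  set R₀ : Set (Matrix (Fin n) (Fin n) (mixedSpace K)) :=
    {H | SiegelFamily.IsReduced c C τ n (SiegelFamily.placeFamily K H)} with hR₀
  set V : Set (Matrix (Fin n) (Fin n) (mixedSpace K)) := convexHull ℝ R₀ with hV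
  -- (2a, b) `R₀ ⊆ C₀` (positivity of reduced families), `V ⊆ C₀` (convexity of the cone)
  have hR₀C₀ : R₀ ⊆ C₀ := fun H hH => hPos.2 n K c C τ H hH
  have hVC₀ : V ⊆ C₀ := convexHull_min hR₀C₀ hconv
  -- (2c) `V` lies in the `(c', C', τ')`-reduced matrices (the Hull Lemma)
  have hVR₁ : ∀ H ∈ V, SiegelFamily.IsReduced c' C' τ' n (SiegelFamily.placeFamily K H) := by
    intro H hH
    have h₁ : SiegelFamily.placeFamily K H ∈ SiegelFamily.placeFamilyₗ K n '' convexHull ℝ R₀ :=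
      ⟨H, hH, rfl⟩
    rw [LinearMap.image_convexHull] at h₁
    have h₂ : (SiegelFamily.placeFamilyₗ K n) '' R₀ ⊆
        {F | SiegelFamily.IsReduced c C τ n F} := by
      rintro _ ⟨y, hy, rfl⟩
      exact hy
    exact hhull (convexHull_mono h₂ h₁)
  -- (2d) `V` is relatively open in the matrices with Hermitian family of places
  obtain ⟨S, hS⟩ := assembly_exists_submodule_placeFamily_isHermitian n K
  obtain ⟨O, hO, hRO⟩ := hOpen (InfinitePlace K) n c C τ
  have hR₀S : R₀ = (S : Set (Matrix (Fin n) (Fin n) (mixedSpace K))) ∩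
      SiegelFamily.placeFamily K ⁻¹' O := by
    ext H
    change SiegelFamily.placeFamily K H ∈ {F | SiegelFamily.IsReduced c C τ n F} ↔ _
    rw [hRO, hS]
    exact Iff.rfl
  obtain ⟨O', hO', hVO'⟩ :=
    assembly_convexHull_inter_relOpen S (hO.preimage (SiegelFamily.continuous_placeFamily n))
  have hVeq : V = (S : Set (Matrix (Fin n) (Fin n) (mixedSpace K))) ∩ O' := by rw [hV, hR₀S, hVO']
  have hXS : ∀ x : ↥C₀, (x : Matrix (Fin n) (Fin n) (mixedSpace K)) ∈
      (S : Set (Matrix (Fin n) (Fin n) (mixedSpace K))) := fun x => by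
    rw [hS]
    exact assembly_placeFamily_isHermitian_of_cone n K x.2.1 x.2.2
  -- the trace `V'` of `V` on the cone is open
  set V' : Set ↥C₀ := {x | (x : Matrix (Fin n) (Fin n) (mixedSpace K)) ∈ V} with hV'
  have hV'mem : ∀ x : ↥C₀, x ∈ V' ↔ (x : Matrix (Fin n) (Fin n) (mixedSpace K)) ∈ V :=
    fun _ => Iff.rfl
  have hV'open : IsOpen V' := by
    have he : V' = Subtype.val ⁻¹' O' := by
      ext x
      rw [hV'mem, hVeq]
      exact ⟨fun h => h.2, fun h => ⟨hXS x, h⟩⟩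
    rw [he]
    exact hO'.preimage continuous_subtype_val
  -- (3) the Siegel set `𝔖♯ = {h : h hᴴ ∈ V}` and the cover data
  set Sg : Set (GL (Fin n) (mixedSpace K)) :=
    {h | (h : Matrix (Fin n) (Fin n) (mixedSpace K)) *
      (h : Matrix (Fin n) (Fin n) (mixedSpace K))ᴴ ∈ V} with hSg
  have hO := SiegelCover.exists_cover_data_of_fundamentalSet_of_siegelProperty
    (X := ↥C₀) θ (globalEmbedding n K) U hUo hUc Sg (Kinf n K) x₀
    (fun g hg => Subtype.ext (by rw [hsmul_coe, hx₀, Matrix.mul_one]; exact (hstab g).2 hg))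
    (fun h hh => (hstab h).1 (by
      have := congrArg Subtype.val hh
      rwa [hsmul_coe, hx₀, Matrix.mul_one] at this))
    (fun x => by
      obtain ⟨g, hg⟩ := htrans x.1 x.2.1 x.2.2
      exact ⟨g, Subtype.ext (by rw [hsmul_coe, hx₀, Matrix.mul_one]; exact hg)⟩)
    ⟨Q₀, hQ₀, fun g => by
      obtain ⟨γ, hγ, b, hb, k', hk', hgbk⟩ := hcov₀ g
      exact ⟨γ, (hf_apply γ).symm ▸ hγ, b, subset_convexHull ℝ R₀ (hin b hb), k', hk', hgbk⟩⟩
    (fun Q hQ => by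
      refine (archSiegelProperty n K Ω' hΩ'B hΩ'inf hΩ'c t' ht' Q hQ).subset ?_
      rintro γ ⟨hγ, b, hb, b', hb', k', hk', hγb⟩
      obtain ⟨b₁, hb₁, hb₁b⟩ := hout _ (hVR₁ _ hb)
      obtain ⟨b₁', hb₁', hb₁b'⟩ := hout _ (hVR₁ _ hb')
      have hk₁ : b₁⁻¹ * b ∈ Kinf n K :=
        (hstab _).1 (assembly_mul_conjTranspose_eq_one_of_eq hb₁b.symm)
      have hk₁' : b₁'⁻¹ * b' ∈ Kinf n K :=
        (hstab _).1 (assembly_mul_conjTranspose_eq_one_of_eq hb₁b'.symm)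
      refine ⟨(hf_apply γ) ▸ hγ, b₁, hb₁, b₁', hb₁', b₁'⁻¹ * b' * k' * (b₁⁻¹ * b)⁻¹,
        mul_mem (mul_mem hk₁' hk') (inv_mem hk₁), ?_⟩
      rw [mul_inv_rev, inv_inv]
      calc θ γ * b₁ = θ γ * b * (b⁻¹ * b₁) := by rw [mul_assoc, mul_inv_cancel_left]
        _ = b' * k' * (b⁻¹ * b₁) := by rw [hγb]
        _ = b₁' * (b₁'⁻¹ * b' * k' * (b⁻¹ * b₁)) := by simp only [mul_assoc, mul_inv_cancel_left])
  obtain ⟨Q, hQc, hcovX, hfinX⟩ := hO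
  -- (4) the free `Γ_U`-set of indices `ι = {γ : γ_f ∈ U · Q}`; the action on the cone through `θ`
  let ι : Type := {γ : GL (Fin n) K // globalEmbedding n K γ ∈ (U : Set (FiniteAdelicGL n K)) * Q}
  letI instι : MulAction ↥(U.comap (globalEmbedding n K)) ι :=
    { smul := fun g i => ⟨g.1 * i.1, by
        obtain ⟨u, hu, q', hq', huq⟩ := Set.mem_mul.1 i.2
        refine Set.mem_mul.2 ⟨globalEmbedding n K g.1 * u, U.mul_mem g.2 hu, q', hq', ?_⟩
        rw [map_mul, ← huq, mul_assoc]⟩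
      one_smul := fun i => Subtype.ext (one_mul _)
      mul_smul := fun g g' i => Subtype.ext (mul_assoc _ _ _) }
  have coe_smul_index : ∀ (g : ↥(U.comap (globalEmbedding n K))) (i : ι),
      ((g • i : ι) : GL (Fin n) K) = g.1 * i.1 := fun _ _ => rfl
  letI instX : MulAction ↥(U.comap (globalEmbedding n K)) ↥C₀ :=
    MulAction.compHom ↥C₀ (θ.comp (U.comap (globalEmbedding n K)).subtype)
  have hΓsmul : ∀ (g : ↥(U.comap (globalEmbedding n K))) (x : ↥C₀), g • x = θ g.1 • x :=
    fun _ _ => rfl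
  -- the cover `W i = θ(i) • V` traced on the cone
  set W : ι → Set ↥C₀ := fun i => {x | (θ i.1)⁻¹ • x ∈ V'} with hW
  have hWmem : ∀ (i : ι) (x : ↥C₀), x ∈ W i ↔ (θ i.1)⁻¹ • x ∈ V' := fun _ _ => Iff.rfl
  -- (5) Brown's criterion in Čech form for the free equivariant good cover
  refine moduleFinite_goodCover (X := ↥C₀) (G := ↥(U.comap (globalEmbedding n K))) (ι := ι)
    W ?_ ?_ ?_ ?_ ?_ ?_ A q
  · -- the cover sets are open in the cone
    intro i
    exact hV'open.preimage (hcont _)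
  · -- they cover the cone (fundamental set)
    intro x _
    obtain ⟨γ, hγ, b, hb, hx⟩ := hcovX x
    refine Set.mem_iUnion.2 ⟨⟨γ, hγ⟩, ?_⟩
    rw [hWmem]
    change (θ γ)⁻¹ • x ∈ V'
    rw [← hx, inv_smul_smul, hV'mem, hsmul_coe, hx₀, Matrix.mul_one]
    exact hb
  · -- non-empty finite intersections are contractible (convexity)
    intro p J hJ
    have hT : Convex ℝ {M : Matrix (Fin n) (Fin n) (mixedSpace K) | ∀ l,
        (((θ (J l).1)⁻¹ : GL (Fin n) (mixedSpace K)) : Matrix (Fin n) (Fin n) (mixedSpace K)) * M *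
          (((θ (J l).1)⁻¹ : GL (Fin n) (mixedSpace K)) :
            Matrix (Fin n) (Fin n) (mixedSpace K))ᴴ ∈ V} := by
      rw [Set.setOf_forall]
      exact convex_iInter fun l =>
        (convex_convexHull ℝ R₀).is_linear_preimage (assembly_isLinearMap_act (θ (J l).1)⁻¹)
    have hce : cechSet W J = {x : ↥C₀ | (x : Matrix (Fin n) (Fin n) (mixedSpace K)) ∈
        {M : Matrix (Fin n) (Fin n) (mixedSpace K) | ∀ l,
          (((θ (J l).1)⁻¹ : GL (Fin n) (mixedSpace K)) : Matrix (Fin n) (Fin n) (mixedSpace K)) *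
            M * (((θ (J l).1)⁻¹ : GL (Fin n) (mixedSpace K)) :
              Matrix (Fin n) (Fin n) (mixedSpace K))ᴴ ∈ V}} := by
      ext x
      rw [mem_cechSet_iff]
      exact Iff.rfl
    rw [hce] at hJ ⊢
    obtain ⟨x, hx⟩ := hJ
    exact assembly_contractibleSpace_subtype_inter hconv hT ⟨x, hx⟩
  · -- equivariance `g • W i = W (g • i)`
    intro g i
    ext x
    constructor
    · rintro ⟨y, hy, rfl⟩
      change g • y ∈ W (g • i)
      rw [hWmem] at hy ⊢
      rw [coe_smul_index, map_mul, hΓsmul, mul_inv_rev, mul_smul, inv_smul_smul]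
      exact hy
    · intro hx
      rw [hWmem, coe_smul_index, map_mul, mul_inv_rev, mul_smul] at hx
      refine ⟨g⁻¹ • x, ?_, smul_inv_smul g x⟩
      rw [hWmem, hΓsmul, Subgroup.coe_inv, map_inv]
      exact hx
  · -- the action on indices is free
    intro g i hgi
    have h := congrArg Subtype.val hgi
    rw [coe_smul_index] at h
    exact Subtype.ext (mul_eq_right.1 h |>.symm ▸ rfl)
  · -- finitely many orbits of nerve simplices (Siegel property)
    intro p
    obtain ⟨S₀, hS₀, hrep⟩ := hfinX p
    refine ⟨{J₀ : Fin (p + 1) → ι | (fun l => (J₀ l).1) ∈ S₀}, ?_, ?_⟩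
    · refine hS₀.preimage ?_
      intro J₁ _ J₂ _ hJ
      funext l
      exact Subtype.ext (congrFun hJ l)
    · intro J hJ
      obtain ⟨x, hx⟩ := hJ
      rw [mem_cechSet_iff] at hx
      have hx' : ∃ x : ↥C₀, ∀ l, ∃ b ∈ Sg, θ (J l).1 • b • x₀ = x := by
        refine ⟨x, fun l => ?_⟩
        have hl := hx l
        rw [hWmem, hV'mem] at hl
        -- the point `θ(J l)⁻¹ • x` of `V ⊆ C₀` is `b bᴴ = b • x₀` (transitivity), and `b ∈ 𝔖♯`
        obtain ⟨b, hb⟩ := htrans _ (hVC₀ hl).1 (hVC₀ hl).2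
        have hy : b • x₀ = (θ (J l).1)⁻¹ • x :=
          Subtype.ext (by rw [hsmul_coe, hx₀, Matrix.mul_one]; exact hb)
        refine ⟨b, ?_, by rw [hy, smul_inv_smul]⟩
        change (b : Matrix (Fin n) (Fin n) (mixedSpace K)) *
          (b : Matrix (Fin n) (Fin n) (mixedSpace K))ᴴ ∈ V
        rw [hb]
        exact hl
      obtain ⟨J₀, hJ₀, g, hg, hgJ⟩ := hrep (fun l => (J l).1) (fun l => (J l).2) hx'
      have hmem : ∀ l, globalEmbedding n K (J₀ l) ∈ (U : Set (FiniteAdelicGL n K)) * Q := by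
        intro l
        obtain ⟨u, hu, q', hq', huq⟩ := Set.mem_mul.1 (J l).2
        refine Set.mem_mul.2 ⟨(globalEmbedding n K g)⁻¹ * u, U.mul_mem (U.inv_mem hg) hu,
          q', hq', ?_⟩
        have hk : J₀ l = g⁻¹ * (J l).1 := by rw [← hgJ l, inv_mul_cancel_left]
        rw [hk, map_mul, map_inv, mul_assoc, huq]
      refine ⟨fun l => ⟨J₀ l, hmem l⟩, hJ₀, ⟨g, hg⟩, ?_⟩
      funext l
      exact Subtype.ext (hgJ l)

end Literature.NumberTheory.Automorphic.BorelSerre1973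

end Part3

/-!
## Part 4 — port of `Summits/Langlands/Langlands/Theorems/IrreducibilityBySelfDualityHeckeEigenvalueFieldBorelSerre.lean`

# Borel–Serre finite-dimensionality: congruence subgroups of `GL_n` over number fields and subgroups of
# finite index of `GL_n(ℤ)` (field coefficients)

With every input proved in the parts above and in `BorelSerreSiegelReducedFamilies.lean` (Brown's criterion in Čech form,
the cone model, the archimedean fundamental set and Siegel property, relative openness / positivity of Siegel-reduced
families, sandwich-in / sandwich-out, the assembly `borelSerre_assembly`, and the Hull Lemma
`SiegelFamily.convexHull_isReduced_subset` of `SiegelReducedFamiliesHull.lean`), the named fact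
`BorelSerre1973_finiteDimensional_groupCohomology_congruenceSubgroup` follows
(`borelSerre1973_finiteDimensional_groupCohomology_congruenceSubgroup_holds`); its `GL_n(ℤ)` sibling
`BorelSerre1973_finiteDimensional_groupCohomology` (subgroups of finite index of `GL_n(ℤ)`, field coefficients) is the
`K = ℚ`, `U = GL_n(𝒪̂)` case: `GL_n(ℚ) ∩ GL_n(𝒪̂) = im GL_n(𝓞_ℚ)` (`comap_glFiniteIntegralLevel_globalEmbedding`),
transported to `GL_n(𝓞_ℚ)` and along `𝓞_ℚ ≃ ℤ` to `GL_n(ℤ)`, and Shapiro's lemma descends to subgroups of finite index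
(`moduleFinite_groupCohomology_subgroup_of_finiteIndex`).  The EXACT-name discharges are the last Part.

## References

* A. Borel, J.-P. Serre, *Corners and arithmetic groups*, Comment. Math. Helv. 48 (1973), §11.1,
  Thm. 11.4.4 [BorelSerre1973].
* K. S. Brown, *Cohomology of Groups*, GTM 87 (1982), III (6.2), VIII (5.1) [Brown1982CohomologyGroups].
-/

section Part4

open scoped _root_.Classical _root_.Pointwise ComplexOrder _root_.Matrix
open _root_.NumberField _root_.IsDedekindDomain _root_.CategoryTheory
open Literature.NumberTheory.Automorphic Literature.Algebra.Homology

namespace Literature.NumberTheory.Automorphic.BorelSerre1973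

open BigHeckeGLn

/-- **HULL-CONVEX — the Hull Lemma** : the convex
hull of the `(c, C, τ)`-reduced families of Hermitian matrices (`SiegelFamily.IsReduced`) lies in
the `(c', C', τ')`-reduced families for constants depending only on `(m, c, C, τ)`.  This is the
Literature theorem `SiegelFamily.convexHull_isReduced_subset` (`SiegelReducedFamiliesHull`):
induction on `m` peeling the last index, the Schur complement of a convex combination exceeding
the combination of the Schur complements by a positive semidefinite slack of controlled size.
[cite: BorelSerre1973, §11.1, Thm. 11.4.4 (arithmetic subgroups of Res_{K/ℚ} GL_n and of GL_n(ℤ) are of type (WFL))] -/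
theorem hull_convex :
    ∀ (ι : Type) (m : ℕ) (c C τ : ℝ), ∃ c' C' τ' : ℝ,
      convexHull ℝ {H : ι → Matrix (Fin m) (Fin m) ℂ | SiegelFamily.IsReduced c C τ m H} ⊆
        {H | SiegelFamily.IsReduced c' C' τ' m H} :=
  fun ι m c C τ => SiegelFamily.convexHull_isReduced_subset (ι := ι) m c C τ

/-- **Borel–Serre for congruence subgroups of `GL_n` over a number field (THEOREM).**  For a field
`k`, a number field `K`, a compact open `U ≤ GL_n(𝔸_K^∞)` and a finite-dimensional representation
`A` of `Γ_U = GL_n(K) ∩ U` over `k`, every `H^q(Γ_U, A)` is finite-dimensional: the named fact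
`BorelSerre1973_finiteDimensional_groupCohomology_congruenceSubgroup` discharged by the
assembly `borelSerre_assembly` fed with the Hull Lemma and the four analytic inputs.
[cite: BorelSerre1973, §11.1, Thm. 11.4.4] -/
theorem borelSerre1973_finiteDimensional_groupCohomology_congruenceSubgroup_holds :
    BorelSerre1973_finiteDimensional_groupCohomology_congruenceSubgroup :=
  fun k _ n K _ _ U hUo hUc A hA q =>
    borelSerre_assembly hull_convex
      (fun ι _ m c C τ => hull_relOpen ι m c C τ) hull_posDef
      (fun n K _ _ Ω h₁ h₂ h₃ t ht => sandwich_in n K Ω h₁ h₂ h₃ t ht)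
      (fun n K _ _ c C τ => sandwich_out n K c C τ) k n K U hUo hUc A hA q

/-- **`GL_n(𝓞_K)` has finite-dimensional cohomology on finite-dimensional coefficients** (every
number field `K`, every field `k`): the congruence subgroup of `U = GL_n(𝒪̂_K)` is the image of
`GL_n(𝓞_K)` in `GL_n(K)` (`comap_glFiniteIntegralLevel_globalEmbedding`), isomorphic to `GL_n(𝓞_K)`
(`map_algebraMap_ringOfIntegers_injective`). [cite: BorelSerre1973, §11.1, Thm. 11.4.4] -/
theorem moduleFinite_groupCohomology_gl_ringOfIntegers (k : Type) [Field k] (n : ℕ) (K : Type)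
    [Field K] [NumberField K] (B : Rep k (GL (Fin n) (𝓞 K))) [Module.Finite k B] (q : ℕ) :
    Module.Finite k (groupCohomology B q) := by
  have h₀ : ∀ (A : Rep k ((glFiniteIntegralLevel n K).comap (globalEmbedding n K))),
      Module.Finite k A → ∀ m, Module.Finite k (groupCohomology A m) :=
    fun A hA m => borelSerre1973_finiteDimensional_groupCohomology_congruenceSubgroup_holds k n K
      (glFiniteIntegralLevel n K) (isOpen_glFiniteIntegralLevel n K)
      (isCompact_glFiniteIntegralLevel_holds n K) A hA m
  rw [comap_glFiniteIntegralLevel_globalEmbedding] at h₀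
  exact moduleFinite_groupCohomology_of_mulEquiv
    (MonoidHom.ofInjective (map_algebraMap_ringOfIntegers_injective n K)).symm h₀ B q

/-- **Borel–Serre for subgroups of finite index of `GL_n(ℤ)` (THEOREM)** — the named fact
`BorelSerre1973_finiteDimensional_groupCohomology`: for a field `k`, `Γ ≤ GL_n(ℤ)` of finite
index and a finite-dimensional `k`-linear representation `A` of `Γ`, every `H^q(Γ, A)` is
finite-dimensional.  From the congruence theorem at `K = ℚ`, `U = GL_n(𝒪̂)`, transport along
`GL_n(𝓞_ℚ) ≃* GL_n(ℤ)` (`Units.mapEquiv` of `Rat.ringOfIntegersEquiv.mapMatrix`), and Shapiro descent to `Γ`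
(`moduleFinite_groupCohomology_subgroup_of_finiteIndex`).
[cite: BorelSerre1973, §11.1, Thm. 11.4.4] [cite: Brown1982CohomologyGroups, III (6.2); VIII (5.1)] -/
theorem borelSerre1973_finiteDimensional_groupCohomology_holds :
    BorelSerre1973_finiteDimensional_groupCohomology := by
  intro k _ n Γ hΓ A hA q
  haveI := hΓ
  haveI : Module.Finite k A := hA
  have hZ : ∀ (B : Rep k (GL (Fin n) ℤ)), Module.Finite k B → ∀ m,
      Module.Finite k (groupCohomology B m) := fun B hB m => by
    haveI := hB
    exact moduleFinite_groupCohomology_of_mulEquiv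
      (Units.mapEquiv (Rat.ringOfIntegersEquiv.mapMatrix (m := Fin n)).toMulEquiv :
        GL (Fin n) (𝓞 ℚ) ≃* GL (Fin n) ℤ)
      (fun C hC m' => by
        haveI := hC
        exact moduleFinite_groupCohomology_gl_ringOfIntegers k n ℚ C m') B m
  exact moduleFinite_groupCohomology_subgroup_of_finiteIndex Γ hZ A q

end Literature.NumberTheory.Automorphic.BorelSerre1973

end Part4

/-! ## Part 5 — the three EXACT discharges -/

namespace Literature.NumberTheory.Automorphic

/-- **The named fact `BorelSerre1973_finite_groupCohomology_congruenceSubgroup` HOLDS** (`ArithmeticQuotientCohomologyFinite.lean`):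
for a number field `K`, a compact open `U ≤ GL_n(𝔸_K^∞)` and a `ℤ[Γ_U]`-module `A` with finitely many elements, every
`H^q(Γ_U, A)` is finite — the finite-coefficient assembly `BorelSerre1973.borelSerre_assembly_finite` fed with the Hull Lemma
(`SiegelFamily.convexHull_isReduced_subset`), the relative openness and positivity of Siegel-reduced families and the two
halves of the sandwich of the archimedean Siegel domain.  EXACT discharge, Literature-side twin of
`Summit.Langlands.Langlands.Theorems.HeckeEigenvalueField.Res.borelSerre1973_finite_groupCohomology_congruenceSubgroup_holds`
(same proof). [cite: BorelSerre1973, §11.1, Thm. 11.4.4] [cite: Brown1982CohomologyGroups, VII (7.10); VIII §2] -/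
theorem BorelSerre1973_finite_groupCohomology_congruenceSubgroup_holds :
    BorelSerre1973_finite_groupCohomology_congruenceSubgroup :=
  fun n K _ _ U hUo hUc A hA q =>
    BorelSerre1973.borelSerre_assembly_finite
      (fun ι m c C τ => SiegelFamily.convexHull_isReduced_subset (ι := ι) m c C τ)
      (fun ι _ m c C τ => BorelSerre1973.hull_relOpen ι m c C τ) BorelSerre1973.hull_posDef
      (fun n K _ _ Ω h₁ h₂ h₃ t ht => BorelSerre1973.sandwich_in n K Ω h₁ h₂ h₃ t ht)
      (fun n K _ _ c C τ => BorelSerre1973.sandwich_out n K c C τ) n K U hUo hUc A hA q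

/-- **The named fact `BorelSerre1973_finiteDimensional_groupCohomology_congruenceSubgroup` HOLDS**
(`CongruenceSubgroupCohomologyFiniteDimensional.lean`): for a field `k`, a number field `K`, a compact open
`U ≤ GL_n(𝔸_K^∞)` and a finite-dimensional representation `A` of `Γ_U = GL_n(K) ∩ U` over `k`, every `H^q(Γ_U, A)` is
finite-dimensional.  EXACT-name restatement of `BorelSerre1973.borelSerre1973_finiteDimensional_groupCohomology_congruenceSubgroup_holds`
(previous Part). [cite: BorelSerre1973, §11.1, Thm. 11.4.4] -/
theorem BorelSerre1973_finiteDimensional_groupCohomology_congruenceSubgroup_holds :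
    BorelSerre1973_finiteDimensional_groupCohomology_congruenceSubgroup :=
  BorelSerre1973.borelSerre1973_finiteDimensional_groupCohomology_congruenceSubgroup_holds

/-- **The named fact `BorelSerre1973_finiteDimensional_groupCohomology` HOLDS** (`ArithmeticGroupCohomologyFiniteness.lean`):
for a field `k`, every `n`, every subgroup `Γ` of finite index in `GL_n(ℤ)`, every finite-dimensional `k`-linear
representation `A` of `Γ` and every `q`, `H^q(Γ, A)` is finite-dimensional over `k`.  EXACT-name restatement of
`BorelSerre1973.borelSerre1973_finiteDimensional_groupCohomology_holds` (previous Part: `K = ℚ`, `U = GL_n(𝒪̂)`, transport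
along `GL_n(𝓞_ℚ) ≃* GL_n(ℤ)`, Shapiro descent). [cite: BorelSerre1973, §11.1, Thm. 11.4.4]
[cite: Brown1982CohomologyGroups, III (6.2); VIII (5.1)] -/
theorem BorelSerre1973_finiteDimensional_groupCohomology_holds :
    BorelSerre1973_finiteDimensional_groupCohomology :=
  BorelSerre1973.borelSerre1973_finiteDimensional_groupCohomology_holds

end Literature.NumberTheory.Automorphic

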